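import Mathlib

/-!
# Conditional-expectation calculus for a law with a density, against a sub-σ-algebra (helper file for
# `AveragedSpecificationLimit`, route SpecificationCompactness, support r9, stmt-QuantumFields-28252)

Abstract measure theory over Mathlib's `condExp` (`μ[f|m]`), for a probability law `π` on a measurable space, a sub-σ-algebra `m ≤ m0`,
and laws `ρ = u·π` with a density `u ≥ 0`.

§1  TOWER / PULL-OUT bookkeeping: `∫ u·h dπ = ∫ π[u|m]·h dπ` for bounded `m`-measurable `h`; `∫ k·π[g|m] dπ = ∫ k·g dπ` for bounded
    `m`-measurable `k`.
§2  **A FIBRE-FREE BAYES BOUND**: for bounded measurable `f`, `q` and the law `ρ = u·π`,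
    `∫ |ρ[f|m] − π[q·f|m]| dρ ≤ ‖f‖∞ · ∫ |u − π[u|m]·q| dπ`
    (test the `m`-measurable difference against its own sign; no disintegration, no division).

This is the first measure-theoretic step of the planner's «Bayes formula + Scheffé on each fibre + Vitali» sketch for
`AveragedSpecificationLimit` ([Georgii2011] Thm 4.17 / [FriedliVelenik2017] Lemma 6.27 pattern), arranged so that no product structure of
`π` is used.  Rung R3 RECORD line; nothing here is specific to Yang–Mills (and nothing about the YM mass gap is proved).
-/

noncomputable section

namespace Summit.QuantumFields.YangMills.Theorems.SpecificationCompactnessKernel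

open MeasureTheory Filter Topology

variable {X : Type*} {m m0 : MeasurableSpace X} {π : Measure X}

/-! ## §1 Tower and pull-out bookkeeping -/

/-- A bounded (a.e.) a.e.-strongly-measurable function is integrable for a finite measure (local helper). [folklore] -/
theorem integrable_of_ae_bound [IsFiniteMeasure π] {f : X → ℝ} (hf : AEStronglyMeasurable f π) {C : ℝ}
    (hC : ∀ᵐ x ∂π, |f x| ≤ C) : Integrable f π :=
  (integrable_const C).mono' hf (hC.mono fun x hx => by simpa [Real.norm_eq_abs] using hx)

/-- `h·g` is integrable for `g` integrable and `h` bounded a.e.-strongly measurable (local helper). [folklore] -/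
theorem integrable_bdd_mul_left {g h : X → ℝ} (hg : Integrable g π) (hh : AEStronglyMeasurable h π) {C : ℝ}
    (hC : ∀ x, |h x| ≤ C) : Integrable (fun x => h x * g x) π :=
  hg.bdd_mul hh (Eventually.of_forall fun x => by rw [Real.norm_eq_abs]; exact hC x)

/-- **TOWER**: `∫ u·h dπ = ∫ π[u|m]·h dπ` for an integrable `u` and a bounded `m`-measurable `h`. [folklore] -/
theorem integral_mul_eq_integral_condExp_mul (hm : m ≤ m0) [IsFiniteMeasure π] {u h : X → ℝ} (hu : Integrable u π)
    (hh : StronglyMeasurable[m] h) {C : ℝ} (hC : ∀ x, |h x| ≤ C) :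
    ∫ x, u x * h x ∂π = ∫ x, π[u|m] x * h x ∂π := by
  have hhm : AEStronglyMeasurable h π := (hh.mono hm).aestronglyMeasurable
  have hhu : Integrable (h * u) π := integrable_bdd_mul_left hu hhm hC
  have h1 : π[h * u|m] =ᵐ[π] h * π[u|m] := condExp_mul_of_stronglyMeasurable_left hh hhu hu
  calc ∫ x, u x * h x ∂π = ∫ x, (h * u) x ∂π := by
        refine integral_congr_ae (Eventually.of_forall fun x => ?_)
        show u x * h x = h x * u x
        ring
    _ = ∫ x, π[h * u|m] x ∂π := (integral_condExp hm).symm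
    _ = ∫ x, (h * π[u|m]) x ∂π := integral_congr_ae h1
    _ = ∫ x, π[u|m] x * h x ∂π := by
        refine integral_congr_ae (Eventually.of_forall fun x => ?_)
        show h x * π[u|m] x = π[u|m] x * h x
        ring

/-- **PULL-OUT UNDER THE INTEGRAL**: `∫ k·π[g|m] dπ = ∫ k·g dπ` for an integrable `g` and a bounded `m`-measurable `k`. [folklore] -/
theorem integral_mul_condExp_eq (hm : m ≤ m0) [IsFiniteMeasure π] {g k : X → ℝ} (hg : Integrable g π)
    (hk : StronglyMeasurable[m] k) {C : ℝ} (hC : ∀ x, |k x| ≤ C) :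
    ∫ x, k x * π[g|m] x ∂π = ∫ x, k x * g x ∂π := by
  have hkm : AEStronglyMeasurable k π := (hk.mono hm).aestronglyMeasurable
  have hkg : Integrable (k * g) π := integrable_bdd_mul_left hg hkm hC
  have h1 : π[k * g|m] =ᵐ[π] k * π[g|m] := condExp_mul_of_stronglyMeasurable_left hk hkg hg
  calc ∫ x, k x * π[g|m] x ∂π = ∫ x, (k * π[g|m]) x ∂π := rfl
    _ = ∫ x, π[k * g|m] x ∂π := (integral_congr_ae h1).symm
    _ = ∫ x, (k * g) x ∂π := integral_condExp hm
    _ = ∫ x, k x * g x ∂π := rfl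

/-- **PULL-OUT for an `m`-measurable factor that is only INTEGRABLE** (not bounded): `∫ k·π[g|m] dπ = ∫ k·g dπ` when `g` is bounded
measurable and `k` is `m`-measurable and integrable. [folklore] -/
theorem integral_mul_condExp_eq' (hm : m ≤ m0) [IsFiniteMeasure π] {g k : X → ℝ} (hg : Measurable g) {B : ℝ}
    (hgB : ∀ x, |g x| ≤ B) (hk : StronglyMeasurable[m] k) (hki : Integrable k π) :
    ∫ x, k x * π[g|m] x ∂π = ∫ x, k x * g x ∂π := by
  have hgi : Integrable g π := integrable_of_ae_bound hg.aestronglyMeasurable (Eventually.of_forall hgB)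
  have hkg : Integrable (k * g) π := by
    have : Integrable (fun x => g x * k x) π := integrable_bdd_mul_left hki hg.aestronglyMeasurable hgB
    exact this.congr (Eventually.of_forall fun x => by show g x * k x = (k * g) x; simp [mul_comm])
  have h1 : π[k * g|m] =ᵐ[π] k * π[g|m] := condExp_mul_of_stronglyMeasurable_left hk hkg hgi
  calc ∫ x, k x * π[g|m] x ∂π = ∫ x, (k * π[g|m]) x ∂π := rfl
    _ = ∫ x, π[k * g|m] x ∂π := (integral_congr_ae h1).symm
    _ = ∫ x, (k * g) x ∂π := integral_condExp hm
    _ = ∫ x, k x * g x ∂π := rfl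

/-! ## §2 The fibre-free Bayes bound -/

/-- Integration against `u·π`: `∫ g d(u·π) = ∫ u·g dπ` (`u ≥ 0` measurable). [folklore] -/
theorem integral_lawOf {u : X → ℝ} (hu : Measurable u) (hu0 : ∀ x, 0 ≤ u x) (g : X → ℝ) :
    ∫ x, g x ∂π.withDensity (fun x => ENNReal.ofReal (u x)) = ∫ x, u x * g x ∂π := by
  rw [integral_withDensity_eq_integral_toReal_smul (hu.ennreal_ofReal)
    (Eventually.of_forall fun x => ENNReal.ofReal_lt_top)]
  refine integral_congr_ae (Eventually.of_forall fun x => ?_)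
  show (ENNReal.ofReal (u x)).toReal • g x = u x * g x
  rw [ENNReal.toReal_ofReal (hu0 x), smul_eq_mul]

/-- `u·π` is a finite measure when `u` is integrable. [folklore] -/
theorem isFiniteMeasure_lawOf {u : X → ℝ} (hui : Integrable u π) :
    IsFiniteMeasure (π.withDensity (fun x => ENNReal.ofReal (u x))) :=
  isFiniteMeasure_withDensity_ofReal hui.2

/-- `u·π ≪ π`. [folklore] -/
theorem lawOf_absolutelyContinuous (u : X → ℝ) : π.withDensity (fun x => ENNReal.ofReal (u x)) ≪ π :=
  withDensity_absolutelyContinuous _ _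

/-- `|·| ∘ h` is `m`-measurable for an `m`-measurable `h` (composition form; avoids instance synthesis on the ambient σ-algebra). [folklore] -/
theorem measurable_abs_comp {h : X → ℝ} (hh : Measurable[m] h) : Measurable[m] fun x => |h x| :=
  continuous_abs.measurable.comp hh

/-- **THE FIBRE-FREE BAYES BOUND.**  For the law `ρ = u·π` (`u ≥ 0` measurable integrable, `π` finite), bounded measurable `f`
(`|f| ≤ B`) and `q` (`|q| ≤ Q`):  `∫ |ρ[f|m] − π[q·f|m]| dρ ≤ B · ∫ |u − π[u|m]·q| dπ`.  Proof: the difference `D` is `m`-measurable;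
test it against `g = sign D` (`m`-measurable, `|g| ≤ 1`): `∫ g·ρ[f|m] dρ = ∫ u·g·f dπ` (pull-out, `ρ = u·π`) and
`∫ g·π[qf|m] dρ = ∫ π[u|m]·g·π[qf|m] dπ = ∫ π[u|m]·g·q·f dπ` (tower, pull-out), so `∫ |D| dρ = ∫ g·f·(u − π[u|m]·q) dπ`. [folklore] -/
theorem integral_abs_condExp_sub_le (hm : m ≤ m0) [IsFiniteMeasure π] {u : X → ℝ} (hu : Measurable u)
    (hu0 : ∀ x, 0 ≤ u x) (hui : Integrable u π) {f q : X → ℝ} (hf : Measurable f) {B : ℝ} (hfB : ∀ x, |f x| ≤ B)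
    (hq : Measurable q) {Q : ℝ} (hqQ : ∀ x, |q x| ≤ Q) :
    ∫ x, |(π.withDensity (fun x => ENNReal.ofReal (u x)))[f|m] x - π[fun y => q y * f y|m] x|
        ∂π.withDensity (fun x => ENNReal.ofReal (u x)) ≤
      B * ∫ x, |u x - π[u|m] x * q x| ∂π := by
  set ρ : Measure X := π.withDensity (fun x => ENNReal.ofReal (u x)) with hρ
  haveI : IsFiniteMeasure ρ := isFiniteMeasure_lawOf hui
  -- integrability facts
  have hfi : Integrable f ρ := integrable_of_ae_bound hf.aestronglyMeasurable (Eventually.of_forall hfB)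
  have hqf_m : Measurable fun y => q y * f y := hq.mul hf
  have hqfB : ∀ x, |q x * f x| ≤ Q * B := fun x => by
    rw [abs_mul]; exact mul_le_mul (hqQ x) (hfB x) (abs_nonneg _) ((abs_nonneg _).trans (hqQ x))
  have hcu_int : Integrable (π[u|m]) π := integrable_condExp
  have hcu_m : StronglyMeasurable[m] (π[u|m]) := stronglyMeasurable_condExp
  have hcqf_m : StronglyMeasurable[m] (π[fun y => q y * f y|m]) := stronglyMeasurable_condExp
  -- the difference and its sign
  set D : X → ℝ := fun x => ρ[f|m] x - π[fun y => q y * f y|m] x with hD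
  have hDm : StronglyMeasurable[m] D := stronglyMeasurable_condExp.sub stronglyMeasurable_condExp
  have hDmeas : Measurable[m] D := hDm.measurable
  set g : X → ℝ := fun x => if 0 ≤ D x then 1 else -1 with hg
  have hgm' : Measurable[m] g :=
    Measurable.ite (measurableSet_le measurable_const hDmeas) measurable_const measurable_const
  have hgm : StronglyMeasurable[m] g := hgm'.stronglyMeasurable
  have hgam : AEStronglyMeasurable g π := (hgm.mono hm).aestronglyMeasurable
  have hg1 : ∀ x, |g x| ≤ 1 := fun x => by simp only [hg]; split_ifs <;> simp
  have habs : ∀ x, |D x| = g x * D x := fun x => by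
    simp only [hg]; split_ifs with h
    · rw [one_mul, abs_of_nonneg h]
    · rw [abs_of_neg (not_le.mp h)]; ring
  -- bounded condExps
  have hcqf_π : ∀ᵐ x ∂π, |π[fun y => q y * f y|m] x| ≤ Q * B := ae_bdd_abs_condExp_of_ae_bdd_abs (Eventually.of_forall hqfB)
  have hcqf : ∀ᵐ x ∂ρ, |π[fun y => q y * f y|m] x| ≤ Q * B := (lawOf_absolutelyContinuous u) hcqf_π
  have hi1 : Integrable (fun x => g x * ρ[f|m] x) ρ :=
    integrable_bdd_mul_left integrable_condExp ((hgm.mono hm).aestronglyMeasurable) hg1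
  have hi2 : Integrable (fun x => g x * π[fun y => q y * f y|m] x) ρ := by
    refine integrable_of_ae_bound (((hgm.mono hm).aestronglyMeasurable).mul ((hcqf_m.mono hm).aestronglyMeasurable))
      (C := Q * B) (hcqf.mono fun x hx => ?_)
    rw [abs_mul]
    exact (mul_le_mul (hg1 x) hx (abs_nonneg _) zero_le_one).trans (one_mul _).le
  -- (i) ∫ g·ρ[f|m] dρ = ∫ u·(g·f) dπ
  have h_i : ∫ x, g x * ρ[f|m] x ∂ρ = ∫ x, u x * (g x * f x) ∂π := by
    rw [integral_mul_condExp_eq hm hfi hgm hg1, hρ, integral_lawOf hu hu0]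
  -- (ii) ∫ g·π[qf|m] dρ = ∫ π[u|m]·g·(q f) dπ
  have hgc_m : StronglyMeasurable[m] fun x => g x * π[fun y => q y * f y|m] x := hgm.mul hcqf_m
  have h_ii : ∫ x, g x * π[fun y => q y * f y|m] x ∂ρ = ∫ x, π[u|m] x * g x * (q x * f x) ∂π := by
    rw [hρ, integral_lawOf hu hu0]
    -- `g·π[qf|m]` is bounded only π-a.e.: replace it by a pointwise-bounded `m`-measurable modification
    have hbd : ∀ᵐ x ∂π, |g x * π[fun y => q y * f y|m] x| ≤ Q * B := hcqf_π.mono fun x hx => by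
      rw [abs_mul]; exact (mul_le_mul (hg1 x) hx (abs_nonneg _) zero_le_one).trans (one_mul _).le
    set k : X → ℝ := fun x => if |g x * π[fun y => q y * f y|m] x| ≤ Q * B then g x * π[fun y => q y * f y|m] x else 0
      with hk
    have hkm : StronglyMeasurable[m] k :=
      (Measurable.ite (measurableSet_le (measurable_abs_comp hgc_m.measurable) measurable_const)
        hgc_m.measurable measurable_const).stronglyMeasurable
    have hkC : ∀ x, |k x| ≤ Q * B := fun x => by
      simp only [hk]; split_ifs with h
      · exact h
      · rw [abs_zero]; exact mul_nonneg ((abs_nonneg _).trans (hqQ x)) ((abs_nonneg _).trans (hfB x))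
    have hk_ae : ∀ᵐ x ∂π, g x * π[fun y => q y * f y|m] x = k x := hbd.mono fun x hx => by
      simp only [hk, if_pos hx]
    calc ∫ x, u x * (g x * π[fun y => q y * f y|m] x) ∂π = ∫ x, u x * k x ∂π :=
          integral_congr_ae (hk_ae.mono fun x hx => by show u x * _ = u x * k x; rw [hx])
      _ = ∫ x, π[u|m] x * k x ∂π := integral_mul_eq_integral_condExp_mul hm hui hkm hkC
      _ = ∫ x, π[u|m] x * (g x * π[fun y => q y * f y|m] x) ∂π :=
          integral_congr_ae (hk_ae.mono fun x hx => by
            show π[u|m] x * k x = π[u|m] x * (g x * π[fun y => q y * f y|m] x); rw [hx])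
      _ = ∫ x, (π[u|m] x * g x) * π[fun y => q y * f y|m] x ∂π :=
          integral_congr_ae (Eventually.of_forall fun x => by
            show π[u|m] x * (g x * π[fun y => q y * f y|m] x) = (π[u|m] x * g x) * π[fun y => q y * f y|m] x
            ring)
      _ = ∫ x, π[u|m] x * g x * (q x * f x) ∂π := by
          -- pull-out with the integrable `m`-measurable factor `π[u|m]·g`
          have hpm : StronglyMeasurable[m] fun x => π[u|m] x * g x := hcu_m.mul hgm
          have hpi : Integrable (fun x => π[u|m] x * g x) π := by
            have := integrable_bdd_mul_left hcu_int hgam hg1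
            exact this.congr (Eventually.of_forall fun x => by show g x * π[u|m] x = π[u|m] x * g x; ring)
          exact integral_mul_condExp_eq' hm hqf_m hqfB hpm hpi
  -- assemble
  have hsplit : ∫ x, |D x| ∂ρ = ∫ x, g x * ρ[f|m] x ∂ρ - ∫ x, g x * π[fun y => q y * f y|m] x ∂ρ := by
    rw [← integral_sub hi1 hi2]
    refine integral_congr_ae (Eventually.of_forall fun x => ?_)
    show |D x| = g x * ρ[f|m] x - g x * π[fun y => q y * f y|m] x
    rw [habs]; simp only [hD]; ring
  -- integrability of the two sides of the final pointwise bound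
  have hL1 : Integrable (fun x => u x * (g x * f x)) π := by
    have := integrable_bdd_mul_left hui (hgam.mul hf.aestronglyMeasurable) (C := 1 * B) (fun x => by
      show |g x * f x| ≤ 1 * B
      rw [abs_mul]; exact mul_le_mul (hg1 x) (hfB x) (abs_nonneg _) zero_le_one)
    exact this.congr (Eventually.of_forall fun x => by show g x * f x * u x = u x * (g x * f x); ring)
  have hL2 : Integrable (fun x => π[u|m] x * g x * (q x * f x)) π := by
    have := integrable_bdd_mul_left hcu_int (hgam.mul hqf_m.aestronglyMeasurable) (C := 1 * (Q * B)) (fun x => by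
      show |g x * (q x * f x)| ≤ 1 * (Q * B)
      rw [abs_mul]; exact mul_le_mul (hg1 x) (hqfB x) (abs_nonneg _) zero_le_one)
    exact this.congr (Eventually.of_forall fun x => by
      show g x * (q x * f x) * π[u|m] x = π[u|m] x * g x * (q x * f x); ring)
  have hkey : ∫ x, |D x| ∂ρ = ∫ x, g x * f x * (u x - π[u|m] x * q x) ∂π := by
    rw [hsplit, h_i, h_ii, ← integral_sub hL1 hL2]
    refine integral_congr_ae (Eventually.of_forall fun x => ?_)
    show u x * (g x * f x) - π[u|m] x * g x * (q x * f x) = g x * f x * (u x - π[u|m] x * q x)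
    ring
  have hRint : Integrable (fun x => B * |u x - π[u|m] x * q x|) π := by
    have h2 : Integrable (fun x => q x * π[u|m] x) π := integrable_bdd_mul_left hcu_int hq.aestronglyMeasurable hqQ
    exact ((hui.sub (h2.congr (Eventually.of_forall fun x => by
      show q x * π[u|m] x = π[u|m] x * q x; ring))).abs).const_mul B
  have hLint : Integrable (fun x => g x * f x * (u x - π[u|m] x * q x)) π :=
    (hL1.sub hL2).congr (Eventually.of_forall fun x => by
      show u x * (g x * f x) - π[u|m] x * g x * (q x * f x) = g x * f x * (u x - π[u|m] x * q x); ring)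
  have hpt : ∀ x, g x * f x * (u x - π[u|m] x * q x) ≤ B * |u x - π[u|m] x * q x| := fun x => by
    calc g x * f x * (u x - π[u|m] x * q x) ≤ |g x * f x * (u x - π[u|m] x * q x)| := le_abs_self _
      _ = |g x| * |f x| * |u x - π[u|m] x * q x| := by rw [abs_mul, abs_mul]
      _ ≤ 1 * B * |u x - π[u|m] x * q x| :=
          mul_le_mul_of_nonneg_right (mul_le_mul (hg1 x) (hfB x) (abs_nonneg _) zero_le_one) (abs_nonneg _)
      _ = B * |u x - π[u|m] x * q x| := by rw [one_mul]
  have hDdef : (fun x => |ρ[f|m] x - π[fun y => q y * f y|m] x|) = fun x => |D x| := rfl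
  rw [hDdef, hkey]
  calc ∫ x, g x * f x * (u x - π[u|m] x * q x) ∂π ≤ ∫ x, B * |u x - π[u|m] x * q x| ∂π := integral_mono hLint hRint hpt
    _ = B * ∫ x, |u x - π[u|m] x * q x| ∂π := integral_const_mul _ _

end Summit.QuantumFields.YangMills.Theorems.SpecificationCompactnessKernel

end
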